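import Summits.Ventures.Crystal3D.Bulk.GapExtremal
import HarnessLib

/-!
# P-L2(a) for the GAP census: at a reduced extremal configuration the tight partners of a shell
# ball lie in no closed tangent half-plane (the two-threshold "concave vertex shifts" lemma)

HONEST FRAMING. Part of the venture `Summits/Ventures/Crystal3D` (cell `pub-crystal3d`, phase 2,
24-hour sprint `PLAN.md` R42; seat typer-bulk-2). A CORE structural brick of the census
completeness hypothesis (`GapCensus.CompleteReduced`, `Bulk/GapExtremal.lean`; cell file
`DESIGN-L12-THEORY.md` P-L2(a): "for a non-rattler vertex, the tight neighbour directions lie in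
no closed half-circle; hence degree `∉ {1, 2}` and every face corner `< 180°`"). The tree proves
the ONE-threshold version for Tammes-optimal codes
(`Literature…SphericalCodeVertexStar.hasShift_of_tangent_halfplane`, Musin–Tarasov 2012 Prop. 3.6
(i) / §3.2); this file re-runs the SAME mechanism in the fourteen-ball, two-threshold setting of the
intruder problem:

* `tightCount_update_lt` — the SHIFT: let `c` be admissible, `i` a shell ball with at least one
  tight partner (another shell ball or the intruder at distance exactly `1`), and `n ≠ 0` a tangent
  vector at `uᵢ = c i - c 0` with EVERY tight partner direction `c j - c 0` in the closed
  half-space `⟪n, ·⟫ ≤ 0`. Replacing `c i` by `c 0 + (uᵢ + ε n)/‖uᵢ + ε n‖` for small `ε > 0`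
  gives an admissible configuration with the same intruder distance and STRICTLY FEWER tight
  pairs (every pair at `i` opens up: `⟪y_ε, q⟫ < ⟪uᵢ, q⟫` for each tight partner `q`, because
  `⟪uᵢ, q⟫ > 0` and `‖uᵢ + ε n‖ > 1`; non-tight pairs keep their slack by continuity).
* `IsReducedExtremal.exists_inner_pos` — hence at a REDUCED EXTREMAL configuration (fewest tight
  pairs among the most-intruding ones, `Bulk/GapExtremal.lean`) no such `n` exists: for every
  nonzero tangent `n` at a shell ball with a tight partner, some tight partner direction has
  `⟪n, c j - c 0⟫ > 0`. This is P-L2(a) at shell vertices (corners `< 180°`, degree `≥ 3` once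
  combined with planarity). The analogous statement at the intruder (move `p` to deepen the hole)
  uses extremality instead and is NOT in this file.

Nothing numerical; nothing is claimed about GAP(1.26).
-/

noncomputable section

open scoped BigOperators InnerProductSpace Topology
open Finset Filter

namespace Summit.Ventures.Crystal3D

variable {c : Fin 14 → EuclideanSpace ℝ (Fin 3)}

/-! ## Distances from a unit vector are monotone in the inner product -/

/-- For unit vectors `y, u` and any `q`: `dist y q < dist u q`… in the form we need:
`⟪y, q⟫ < ⟪u, q⟫ → dist u q < dist y q` (`dist v q ² = 1 - 2⟪v, q⟫ + ‖q‖²`). -/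
theorem dist_lt_dist_of_inner_lt {y u q : EuclideanSpace ℝ (Fin 3)} (hy : ‖y‖ = 1) (hu : ‖u‖ = 1)
    (h : ⟪y, q⟫_ℝ < ⟪u, q⟫_ℝ) : dist u q < dist y q := by
  have hy2 : dist y q ^ 2 = 1 - 2 * ⟪y, q⟫_ℝ + ‖q‖ ^ 2 := by
    rw [dist_eq_norm, norm_sub_sq_real, hy]; ring
  have hu2 : dist u q ^ 2 = 1 - 2 * ⟪u, q⟫_ℝ + ‖q‖ ^ 2 := by
    rw [dist_eq_norm, norm_sub_sq_real, hu]; ring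
  have hlt : dist u q ^ 2 < dist y q ^ 2 := by rw [hy2, hu2]; linarith
  exact lt_of_pow_lt_pow_left₀ 2 dist_nonneg hlt

/-- A tight partner of a shell ball is seen at a POSITIVE inner product from it: if `‖u‖ = 1`,
`dist 0 q ≥ 1` (i.e. `‖q‖ ≥ 1`) and `dist u q = 1` then `⟪u, q⟫ = ‖q‖²/2 > 0`. -/
theorem inner_pos_of_tight {u q : EuclideanSpace ℝ (Fin 3)} (hu : ‖u‖ = 1) (hq : 1 ≤ ‖q‖)
    (hd : dist u q = 1) : 0 < ⟪u, q⟫_ℝ := by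
  have h2 : dist u q ^ 2 = 1 - 2 * ⟪u, q⟫_ℝ + ‖q‖ ^ 2 := by
    rw [dist_eq_norm, norm_sub_sq_real, hu]; ring
  rw [hd] at h2
  nlinarith [h2, hq]

/-! ## The shift -/

/-- **The two-threshold shift.** Let `c` be an admissible configuration, `i` a shell ball and
`n ≠ 0` a tangent vector at `uᵢ = c i - c 0` such that every tight partner `j` of `i`
(`j ≠ 0`, `j ≠ i`, `dist (c i) (c j) = 1` — other shell balls or the intruder) has
`⟪n, c j - c 0⟫ ≤ 0`. Then for some unit vector `y` the configuration `c` with `c i` replaced by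
`c 0 + y` is admissible, and every pair at `i` is NON-tight in it. -/
theorem exists_update_open (hc : IsGapConfig c) {i : Fin 14} (hi0 : i ≠ 0) (hi13 : i ≠ 13)
    {n : EuclideanSpace ℝ (Fin 3)} (hn : n ≠ 0) (hnt : ⟪c i - c 0, n⟫_ℝ = 0)
    (hle : ∀ j : Fin 14, j ≠ 0 → j ≠ i → dist (c i) (c j) = 1 → ⟪n, c j - c 0⟫_ℝ ≤ 0) :
    ∃ y : EuclideanSpace ℝ (Fin 3), ‖y‖ = 1 ∧
      ∀ j : Fin 14, j ≠ 0 → j ≠ i → 1 < dist (c 0 + y) (c j) := by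
  set u : EuclideanSpace ℝ (Fin 3) := c i - c 0 with hudef
  have hu : ‖u‖ = 1 := by rw [hudef, ← dist_eq_norm]; exact hc.2 i hi0 hi13
  -- the curve of unit vectors `y ε = (u + ε n)/‖u + ε n‖`
  set z : ℝ → EuclideanSpace ℝ (Fin 3) := fun ε => u + ε • n with hzdef
  have hz2 : ∀ ε, ‖z ε‖ ^ 2 = 1 + ε ^ 2 * ‖n‖ ^ 2 := by
    intro ε
    simp only [hzdef]
    rw [norm_add_sq_real, hu, real_inner_smul_right, hnt, norm_smul, mul_pow,
      Real.norm_eq_abs, sq_abs]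
    ring
  have hz1 : ∀ ε, 0 < ε → 1 < ‖z ε‖ := by
    intro ε hε
    have hn2 : 0 < ‖n‖ ^ 2 := by positivity
    have : 1 < ‖z ε‖ ^ 2 := by rw [hz2]; nlinarith [mul_pos (pow_pos hε 2) hn2]
    exact lt_of_pow_lt_pow_left₀ 2 (norm_nonneg _) (by simpa using this)
  set y : ℝ → EuclideanSpace ℝ (Fin 3) := fun ε => ‖z ε‖⁻¹ • z ε with hydef
  have hy1 : ∀ ε, 0 < ε → ‖y ε‖ = 1 := by
    intro ε hε
    have h0 : ‖z ε‖ ≠ 0 := by linarith [hz1 ε hε]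
    simp only [hydef]
    rw [norm_smul, norm_inv, norm_norm, inv_mul_cancel₀ h0]
  -- tight partners open up for every `ε > 0`
  have htight : ∀ ε, 0 < ε → ∀ j : Fin 14, j ≠ 0 → j ≠ i → dist (c i) (c j) = 1 →
      1 < dist (c 0 + y ε) (c j) := by
    intro ε hε j hj0 hji hd
    set q : EuclideanSpace ℝ (Fin 3) := c j - c 0 with hqdef
    have hdq : dist u q = 1 := by rw [hudef, hqdef, dist_sub_right]; exact hd
    have hq1 : 1 ≤ ‖q‖ := by
      rw [hqdef, ← dist_eq_norm]; exact hc.1 j 0 hj0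
    have hpos : 0 < ⟪u, q⟫_ℝ := inner_pos_of_tight hu hq1 hdq
    have hin : ⟪y ε, q⟫_ℝ = ‖z ε‖⁻¹ * (⟪u, q⟫_ℝ + ε * ⟪n, q⟫_ℝ) := by
      simp only [hydef, hzdef]
      rw [real_inner_smul_left, inner_add_left, real_inner_smul_left]
    have hz := hz1 ε hε
    have hzinv : ‖z ε‖⁻¹ < 1 := inv_lt_one_of_one_lt₀ hz
    have hzinv0 : 0 < ‖z ε‖⁻¹ := inv_pos.2 (by linarith)
    have hlt : ⟪y ε, q⟫_ℝ < ⟪u, q⟫_ℝ := by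
      rw [hin]
      have h1 : ⟪u, q⟫_ℝ + ε * ⟪n, q⟫_ℝ ≤ ⟪u, q⟫_ℝ := by
        nlinarith [mul_nonpos_of_nonneg_of_nonpos hε.le (hle j hj0 hji hd)]
      calc ‖z ε‖⁻¹ * (⟪u, q⟫_ℝ + ε * ⟪n, q⟫_ℝ) ≤ ‖z ε‖⁻¹ * ⟪u, q⟫_ℝ :=
            mul_le_mul_of_nonneg_left h1 hzinv0.le
        _ < 1 * ⟪u, q⟫_ℝ := mul_lt_mul_of_pos_right hzinv hpos
        _ = ⟪u, q⟫_ℝ := one_mul _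
    have := dist_lt_dist_of_inner_lt (hy1 ε hε) hu hlt
    rw [hdq] at this
    have e : dist (c 0 + y ε) (c j) = dist (y ε) q := by
      rw [hqdef, dist_eq_norm, dist_eq_norm]; congr 1; abel
    rwa [e]
  -- `y ε → u` as `ε → 0⁺`, so non-tight partners keep their slack
  have hcont : Tendsto y (𝓝[>] 0) (𝓝 u) := by
    have hzc : Continuous z := by
      simp only [hzdef]; exact continuous_const.add (continuous_id.smul continuous_const)
    have hz0 : z 0 = u := by simp [hzdef]
    have hnc : ContinuousAt (fun ε => ‖z ε‖⁻¹) 0 := by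
      refine (hzc.norm.continuousAt).inv₀ ?_
      rw [hz0, hu]; exact one_ne_zero
    have hyc : ContinuousAt y 0 := by
      simp only [hydef]; exact hnc.smul hzc.continuousAt
    have hy0 : y 0 = u := by simp only [hydef]; rw [hz0, hu]; simp
    have := hyc.tendsto
    rw [hy0] at this
    exact this.mono_left nhdsWithin_le_nhds
  have hfar : ∀ᶠ ε in 𝓝[>] (0 : ℝ), ∀ j : Fin 14, j ≠ 0 → j ≠ i → dist (c i) (c j) ≠ 1 →
      1 < dist (c 0 + y ε) (c j) := by
    refine eventually_all.2 fun j => ?_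
    by_cases hj0 : j = 0
    · exact Eventually.of_forall fun ε h => absurd hj0 h
    by_cases hji : j = i
    · exact Eventually.of_forall fun ε _ h => absurd hji h
    by_cases hd : dist (c i) (c j) = 1
    · exact Eventually.of_forall fun ε _ _ h => absurd hd h
    · have hgt : 1 < dist (c 0 + u) (c j) := by
        have e : c 0 + u = c i := by rw [hudef]; abel
        rw [e]; exact lt_of_le_of_ne (hc.1 i j (Ne.symm hji)) (Ne.symm hd)
      have hopen : IsOpen {w : EuclideanSpace ℝ (Fin 3) | 1 < dist (c 0 + w) (c j)} :=
        isOpen_lt continuous_const ((continuous_const.add continuous_id).dist continuous_const)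
      have hmem : {w : EuclideanSpace ℝ (Fin 3) | 1 < dist (c 0 + w) (c j)} ∈ 𝓝 u :=
        hopen.mem_nhds hgt
      exact (hcont.eventually_mem hmem).mono fun ε hε _ _ _ => hε
  have hpos : ∀ᶠ ε in 𝓝[>] (0 : ℝ), 0 < ε := eventually_nhdsWithin_of_forall fun ε hε => hε
  obtain ⟨ε, hε, hεfar⟩ := (hpos.and hfar).exists
  refine ⟨y ε, hy1 ε hε, fun j hj0 hji => ?_⟩
  by_cases hd : dist (c i) (c j) = 1
  · exact htight ε hε j hj0 hji hd
  · exact hεfar j hj0 hji hd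

/-- The shifted configuration: `c` with ball `i` moved to `c 0 + y`. -/
theorem isGapConfig_update (hc : IsGapConfig c) {i : Fin 14} (hi0 : i ≠ 0) (hi13 : i ≠ 13)
    {y : EuclideanSpace ℝ (Fin 3)} (hy : ‖y‖ = 1)
    (hopen : ∀ j : Fin 14, j ≠ 0 → j ≠ i → 1 < dist (c 0 + y) (c j)) :
    IsGapConfig (Function.update c i (c 0 + y)) := by
  have h0 : Function.update c i (c 0 + y) 0 = c 0 := Function.update_of_ne hi0.symm _ _
  have hdi0 : dist (c 0 + y) (c 0) = 1 := by
    rw [dist_eq_norm, add_sub_cancel_left, hy]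
  refine ⟨fun a b hab => ?_, fun a ha0 ha13 => ?_⟩
  · by_cases ha : a = i
    · subst ha
      rw [Function.update_self, Function.update_of_ne (Ne.symm hab)]
      by_cases hb0 : b = 0
      · rw [hb0, hdi0]
      · exact (hopen b hb0 (Ne.symm hab)).le
    by_cases hb : b = i
    · subst hb
      rw [Function.update_self, Function.update_of_ne ha, dist_comm]
      by_cases ha0 : a = 0
      · rw [ha0, hdi0]
      · exact (hopen a ha0 ha).le
    rw [Function.update_of_ne ha, Function.update_of_ne hb]
    exact hc.1 a b hab
  · rw [h0]
    by_cases ha : a = i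
    · subst ha; rw [Function.update_self, hdi0]
    · rw [Function.update_of_ne ha]; exact hc.2 a ha0 ha13

/-- The shift does not move the centre or the intruder. -/
theorem intruderDist_update {i : Fin 14} (hi0 : i ≠ 0) (hi13 : i ≠ 13)
    (v : EuclideanSpace ℝ (Fin 3)) : intruderDist (Function.update c i v) = intruderDist c := by
  unfold intruderDist
  rw [Function.update_of_ne hi0.symm, Function.update_of_ne hi13.symm]

/-- **The shift strictly decreases the number of tight pairs** when ball `i` had a tight
partner. -/
theorem tightCount_update_lt {i : Fin 14} (hi0 : i ≠ 0)
    (htight : ∃ j : Fin 14, j ≠ 0 ∧ j ≠ i ∧ dist (c i) (c j) = 1)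
    {y : EuclideanSpace ℝ (Fin 3)}
    (hopen : ∀ j : Fin 14, j ≠ 0 → j ≠ i → 1 < dist (c 0 + y) (c j)) :
    tightCount (Function.update c i (c 0 + y)) < tightCount c := by
  classical
  obtain ⟨j, hj0, hji, hd⟩ := htight
  unfold tightCount
  -- the new tight pairs are old tight pairs not involving `i`
  set S := (univ ×ˢ univ).filter fun q : Fin 14 × Fin 14 =>
    q.1 ≠ 0 ∧ q.1 < q.2 ∧ dist (c q.1) (c q.2) = 1 with hS
  set S' := (univ ×ˢ univ).filter fun q : Fin 14 × Fin 14 =>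
    q.1 ≠ 0 ∧ q.1 < q.2 ∧
      dist (Function.update c i (c 0 + y) q.1) (Function.update c i (c 0 + y) q.2) = 1 with hS'
  have hnot : ∀ q ∈ S', q.1 ≠ i ∧ q.2 ≠ i := by
    intro q hq
    obtain ⟨hq0, hlt, hdq⟩ := (mem_filter.1 hq).2
    constructor
    · intro h1
      rw [h1, Function.update_self, Function.update_of_ne (ne_of_gt (h1 ▸ hlt))] at hdq
      have hq20 : q.2 ≠ 0 := fun h => by rw [h] at hlt; exact absurd (h1 ▸ hlt) (Fin.not_lt_zero _)
      exact absurd hdq (ne_of_gt (hopen q.2 hq20 (ne_of_gt (h1 ▸ hlt))))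
    · intro h2
      rw [h2, Function.update_self, Function.update_of_ne (ne_of_lt (h2 ▸ hlt)), dist_comm] at hdq
      exact absurd hdq (ne_of_gt (hopen q.1 hq0 (ne_of_lt (h2 ▸ hlt))))
  have hsub : S' ⊆ S := by
    intro q hq
    obtain ⟨h1, h2⟩ := hnot q hq
    obtain ⟨hq0, hlt, hdq⟩ := (mem_filter.1 hq).2
    rw [Function.update_of_ne h1, Function.update_of_ne h2] at hdq
    exact mem_filter.2 ⟨mem_product.2 ⟨mem_univ _, mem_univ _⟩, hq0, hlt, hdq⟩
  -- the old tight pair `{i, j}` is lost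
  have hpair : (min i j, max i j) ∈ S ∧ (min i j, max i j) ∉ S' := by
    constructor
    · refine mem_filter.2 ⟨mem_product.2 ⟨mem_univ _, mem_univ _⟩, ?_, ?_, ?_⟩
      · rcases le_total i j with h | h
        · rw [min_eq_left h]; exact hi0
        · rw [min_eq_right h]; exact hj0
      · exact min_lt_max.2 (Ne.symm hji)
      · rcases le_total i j with h | h
        · rw [min_eq_left h, max_eq_right h]; exact hd
        · rw [min_eq_right h, max_eq_left h, dist_comm]; exact hd
    · intro hq
      obtain ⟨h1, h2⟩ := hnot _ hq
      rcases le_total i j with h | h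
      · exact h1 (min_eq_left h)
      · exact h2 (max_eq_left h)
  exact card_lt_card ⟨hsub, fun hSS => hpair.2 (hSS hpair.1)⟩

/-! ## P-L2(a) at shell vertices of a reduced extremal configuration -/

/-- **No closed tangent half-plane contains all tight partners of a shell ball** at a reduced
extremal configuration (DESIGN-L12-THEORY P-L2(a), Musin–Tarasov 2012 Prop. 3.6 (i), two-threshold
form): if ball `i ∉ {0, 13}` has a tight partner, then for every nonzero tangent vector `n` at
`c i - c 0` some tight partner `j` (a shell ball or the intruder) has `⟪n, c j - c 0⟫ > 0`.
Otherwise the shift above produces an admissible configuration with the same intruder distance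
and fewer tight pairs, contradicting `IsReducedExtremal`. -/
theorem IsReducedExtremal.exists_inner_pos (hc : IsReducedExtremal c) {i : Fin 14} (hi0 : i ≠ 0)
    (hi13 : i ≠ 13) (htight : ∃ j : Fin 14, j ≠ 0 ∧ j ≠ i ∧ dist (c i) (c j) = 1)
    {n : EuclideanSpace ℝ (Fin 3)} (hn : n ≠ 0) (hnt : ⟪c i - c 0, n⟫_ℝ = 0) :
    ∃ j : Fin 14, j ≠ 0 ∧ j ≠ i ∧ dist (c i) (c j) = 1 ∧ 0 < ⟪n, c j - c 0⟫_ℝ := by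
  by_contra h
  push Not at h
  obtain ⟨y, hy, hopen⟩ := exists_update_open hc.1.1 hi0 hi13 hn hnt h
  have hc' : IsGapConfig (Function.update c i (c 0 + y)) :=
    isGapConfig_update hc.1.1 hi0 hi13 hy hopen
  have hlt := tightCount_update_lt hi0 htight hopen
  have := hc.intruderDist_lt_of_tightCount_lt hc' hlt
  rw [intruderDist_update hi0 hi13] at this
  exact lt_irrefl _ this

end Summit.Ventures.Crystal3D

end
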